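import Literature.NumberTheory.EllipticCurves.ManinConstantSemistablePrimewise
import Literature.NumberTheory.EllipticCurves.ModularCurvePeriodRatioTwoProofs
import Literature.NumberTheory.EllipticCurves.PastenSpectralDegreeIsogenyBoundProofs
import Literature.NumberTheory.EllipticCurves.TwoTorsionOddDegreeBaseChangeProofs
import Literature.NumberTheory.EllipticCurves.ModTwoReducibleIffTwoTorsionRoot
import Literature.NumberTheory.EllipticCurves.NonEisensteinPrimeOfSurjective
import Summits.BirchSwinnertonDyer.BirchSwinnertonDyer.Theorems.GenusKolyvaginAtTwoMinimalTwinBSDTwoAnalyticTwinNoTwoTorsionCensus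
import HarnessLib

/-!
# Route `GenusKolyvaginAtTwo`, crux U₂ `MinimalTwinBSDTwo` (stmt-BirchSwinnertonDyer-22985), LINE 23 «twin_swap» — THE ODD MANIN DATUM:
# on `4 ∤ N`, every globally minimal `W/ℚ` with `E[2]` irreducible carries a modular parametrisation datum with ODD Manin constant

Seat `bsd-line-gk2-p2` g33 (PROVER seat 2/3, cell `bsd-f1-sign2`, LINE 23 holder), `--supports stmt-BirchSwinnertonDyer-22985 --as helper`.
THEOREMS ONLY (no definition, no named fact, no `sorry`).  BSD is NOT proved by any of this; U₂ is NOT proved; nothing is closed.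

WHAT.  The FRAME leaf of LINE 23 (FRAME♮ of v2.9, FRAME♭ of v2.9′, the `hSupplyD` binder of
`TwinAnnihilation.minimalTwinBSDTwo_onOddCut_of_wall_of_deepTwinClassFrameSupply_of_facts`, p815975) asks, per curve `W` on the odd habitat cut,
for a datum `Dt : ModularParametrizationData W N_W` with `Odd Dt.c` (the Manin constant of the parametrisation enters the Heegner index through
`4^{v₂(c)}`).  REF2 NN3 (2026-08-31): on `4 ∤ N` this clause is IN PRINT — Abbes–Ullmo 1996 Thm. A (`2 ∤ N ⇒ 2 ∤ c_E`) / Česnavičius 2018 Thm. 1.2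
(`2 ∥ N ⇒ 2 ∤ c_E`) for the STRONG WEIL curve, plus odd-isogeny transport inside an `E[2]`-irreducible class.  This file performs the transport in
the kernel, from the tree's two NAMED FACTS `abbesUllmo_not_dvd_maninConstant_of_not_dvd_level`, `cesnavicius_not_two_dvd_maninConstant_of_two_dvd_level`
(`ManinConstantSemistablePrimewise.lean`) and the tree's THEOREMS: Edixhoven integrality (`edixhoven_int_of_neronLattice_eq_smul_periodLattice_holds`,
whence the optimal datum on a globally minimal model of the strong Weil curve, `ModularParametrizationData.exists_optimalDatum_of_edixhoven`), the
prime-to-`2` isogeny of an `E[2]`-irreducible class (`SkinnerUrban2014.exists_isogeny_not_dvd_degree_of_irreducible`, Greenberg–Vatsal 2000 Rem. 3.4),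
the lattice form of an isogeny with its degree (`exists_rat_mulLeft_lattice_le_of_isogeny`), Néron integrality of its scaling
(`integral_neronScaling_of_isGloballyMinimal_holds`) and the change of Manin constant of a datum (`ModularParametrizationData.exists_datum_c_eq`).

* §1 `exists_datum_odd_c_of_irreducible_two_of_not_four_dvd` — for `W` globally minimal with `E[2]` irreducible, a datum `D` at level `N`, `4 ∤ N`:
  a datum `Dt` at level `N` with the SAME newform, period pair and uniformisation and `Odd Dt.c` (mod AU + Čes).  Mechanism: optimal `(W₀, D₀)` with
  `Λ_{W₀} = c₀Λ_f`, `c₀` odd (AU/Čes at `p = 2`); an isogeny `ψ : W → W₀` of odd degree `d`; `ψ = (z ↦ rz)`, `rΛ_W ⊆ Λ_{W₀}` of index `d`, so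
  `dΛ_{W₀} ⊆ rΛ_W`, `μ := d/r`, `r, μ ∈ ℤ`, `rμ = d` odd ⇒ `μ` odd; `k := μc₀` is odd and `kΛ_f = μ c₀Λ_f ⊆ μΛ_{W₀} ⊆ Λ_W`.
* §2 corollaries in the route's currencies: `E[2]` irreducible from `ρ̄_{W,2}` onto / from «no rational `2`-torsion»; the level-`N_W` form with the
  modularity fact `nonempty_modularParametrizationData`.
* §3 the optimal case needs no isogeny: a lattice-optimal datum on `4 ∤ N` has odd `c` (AU/Čes verbatim) — the habitat clause of `GenusPrimitiveSupplyAtTwo`.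

HONEST FRAMING.  CONDITIONAL on the two displayed named facts (printed theorems, not formalised: Néron models of `J₀(N)`); on `4 ∣ N` (additive
reduction at `2` with `v₂(N) ≥ 2`) nothing is claimed (Manin's conjecture there is open in print).  Nothing beyond print; BSD is NOT proved.

References: [AbbesUllmo1996] Thm. A; [Cesnavicius2018] Thm. 1.2; [EdixhovenManin1991] Prop. 2; [GreenbergVatsal2000] §3 Rem. 3.4;
[AgasheRibetStein2006] Thm. 2.2, 2.5; [SilvermanAEC2009] VI.4.1(b), III.4.11.
-/

set_option autoImplicit false
set_option linter.dupNamespace false -- `Summit.<P>.<Sub>` repeats `BirchSwinnertonDyer` (D-0017)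

noncomputable section

open scoped Classical MatrixGroups ModularForm

namespace Summit.BirchSwinnertonDyer.BirchSwinnertonDyer.Theorems.GenusExact.TwinSwap.OddManin

open Literature.NumberTheory.EllipticCurves WeierstrassCurve CongruenceSubgroup
  Literature.NumberTheory.EllipticCurves.ModularForms

/-! ## §1 The odd Manin datum of an `E[2]`-irreducible curve on `4 ∤ N` -/

/-- **The odd Manin datum.**  Let `W/ℚ` be globally minimal elliptic with `E[2]` irreducible, `D` a modular parametrisation datum of `W` at level
`N` with `4 ∤ N`.  Granted Abbes–Ullmo's Thm. A and Česnavičius's Thm. 1.2 (case `2 ∥ N`) for the strong Weil curve (named facts, lattice rendering),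
`W` carries a datum `Dt` at level `N` with the same newform, period pair and uniformisation as `D` and ODD Manin constant `Dt.c`.
Proof: the optimal datum `D₀` on a globally minimal model `W₀` of the strong Weil curve (Edixhoven, tree theorem) has `c₀` odd (the two facts at
`p = 2`); `E[2]` irreducible gives an isogeny `ψ : W → W₀` of odd degree `d` (Greenberg–Vatsal Rem. 3.4, tree theorem), i.e. `rΛ_W ⊆ Λ_{W₀}` of index
`d` with `r ∈ ℚ`; then `μ := d/r` has `μΛ_{W₀} ⊆ Λ_W`, both `r, μ ∈ ℤ` by Néron integrality (tree theorem) and `rμ = d` is odd, so `k := μ·c₀` is an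
odd integer with `kΛ_f ⊆ Λ_W`, the Manin constant of the datum `exists_datum_c_eq`.  CONDITIONAL on the two named facts; BSD is NOT proved.
[cite: AbbesUllmo1996, Thm. A] [cite: Cesnavicius2018, Thm. 1.2 (p = 2, ord_2(n) = 1)] [cite: GreenbergVatsal2000, §3, Remark 3.4]
[cite: EdixhovenManin1991, Prop. 2] -/
theorem exists_datum_odd_c_of_irreducible_two_of_not_four_dvd
    (hAU : abbesUllmo_not_dvd_maninConstant_of_not_dvd_level) (hCes : cesnavicius_not_two_dvd_maninConstant_of_two_dvd_level)
    (W : WeierstrassCurve ℚ) [W.IsElliptic] [W.IsGloballyMinimal] (hirr : W.HasIrreducibleModPGaloisRep 2)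
    {N : ℕ} [NeZero N] (D : ModularParametrizationData W N) (h4 : ¬ 4 ∣ N) :
    ∃ Dt : ModularParametrizationData W N, Dt.f = D.f ∧ Dt.L = D.L ∧ Dt.uniformize = D.uniformize ∧ Odd Dt.c := by
  -- the optimal datum on a globally minimal model of the strong Weil curve
  obtain ⟨W₀, hW₀, hW₀', D₀, hf₀, hiso, hopt, -⟩ := D.exists_optimalDatum_of_edixhoven
    (fun hf' hL' q hq hq' ↦ edixhoven_int_of_neronLattice_eq_smul_periodLattice_holds hf' hL' q hq hq')
  -- its Manin constant is odd (Abbes–Ullmo at `2 ∤ N`, Česnavičius at `2 ∥ N`)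
  have hc₀ : ¬ (2 : ℤ) ∣ D₀.c := by
    have h4' : ¬ 2 ^ 2 ∣ N := by norm_num; exact h4
    by_cases h2 : 2 ∣ N
    · exact hCes W₀ D₀ hopt h2 h4'
    · exact_mod_cast hAU W₀ D₀ hopt 2 Nat.prime_two h2
  -- an isogeny `W → W₀` of odd degree
  obtain ⟨ψ, hψ⟩ := SkinnerUrban2014.exists_isogeny_not_dvd_degree_of_irreducible (p := 2) (W := W) (W' := W₀)
    (by norm_num) hirr hiso
  -- lattice form: `rΛ_W ⊆ Λ_{W₀}` of index `d`
  obtain ⟨r, hr0, hle, hidx⟩ := exists_rat_mulLeft_lattice_le_of_isogeny W W₀ D.isNeronLattice D₀.isNeronLattice ψ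
  set d : ℕ := ψ.degree with hd
  have hmem : ∀ z ∈ D.L.lattice, ((r : ℚ) : ℂ) * z ∈ D₀.L.lattice := fun z hz ↦
    hle (PeriodPair.mul_mem_mulLeft_lattice.mpr hz)
  obtain ⟨q, hq⟩ := integral_neronScaling_of_isGloballyMinimal_holds W W₀ D.L D₀.L D.isNeronLattice D₀.isNeronLattice r hmem
  -- `dΛ_{W₀} ⊆ rΛ_W`, i.e. `(d/r)Λ_{W₀} ⊆ Λ_W`
  have hdmem : ∀ z ∈ D₀.L.lattice, ((d / r : ℚ) : ℂ) * z ∈ D.L.lattice := by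
    intro z hz
    have h1 : d • z ∈ (D.L.mulLeft (r : ℂ) hr0).lattice := by
      have h2 := AddSubgroup.nsmul_relIndex_mem (D.L.mulLeft (r : ℂ) hr0).lattice.toAddSubgroup
        (K := D₀.L.lattice.toAddSubgroup) (g := z) hz
      rw [hidx] at h2
      exact h2
    rw [PeriodPair.mem_mulLeft_lattice, nsmul_eq_mul] at h1
    have e : ((d / r : ℚ) : ℂ) * z = ((r : ℚ) : ℂ)⁻¹ * ((d : ℂ) * z) := by
      push_cast
      ring
    rw [e]
    exact h1
  obtain ⟨μ, hμ⟩ := integral_neronScaling_of_isGloballyMinimal_holds W₀ W D₀.L D.L D₀.isNeronLattice D.isNeronLattice (d / r) hdmem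
  have hr0' : (r : ℚ) ≠ 0 := by
    rintro rfl
    exact hr0 (by push_cast; rfl)
  have hqμ : q * μ = d := by
    have h : (q : ℚ) * μ = d := by
      rw [hq, hμ]
      field_simp
    exact_mod_cast h
  -- `d` odd, hence `μ` odd
  have hdodd : Odd (d : ℤ) := by
    have : ¬ 2 ∣ d := hψ
    exact_mod_cast Nat.odd_iff.mpr (Nat.two_dvd_ne_zero.mp this)
  have hμodd : Odd μ := by
    rw [← hqμ] at hdodd
    exact (Int.odd_mul.mp hdodd).2
  have hc₀odd : Odd D₀.c := by
    rcases Int.even_or_odd D₀.c with h | h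
    · exact absurd (even_iff_two_dvd.mp h) hc₀
    · exact h
  -- the odd integer `k := μ c₀` has `kΛ_f ⊆ Λ_W`
  have hk : ∀ z ∈ periodLattice D.f, ((μ * D₀.c : ℤ) : ℂ) * z ∈ D.L.lattice := by
    intro z hz
    have hz₀ : (D₀.c : ℂ) * z ∈ D₀.L.lattice := D₀.smul_periodLattice_le z (hf₀ ▸ hz)
    have h1 := hdmem _ hz₀
    have e : ((μ * D₀.c : ℤ) : ℂ) * z = ((d / r : ℚ) : ℂ) * ((D₀.c : ℂ) * z) := by
      rw [← hμ]
      push_cast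
      ring
    rw [e]
    exact h1
  have hk0 : μ * D₀.c ≠ 0 := by
    have h1 := Int.odd_iff.mp hμodd
    have h2 := Int.odd_iff.mp hc₀odd
    intro h0
    rcases mul_eq_zero.mp h0 with h | h <;> omega
  obtain ⟨Dk, hfk, hLk, huk, hck⟩ := D.exists_datum_c_eq hk0 hk
  exact ⟨Dk, hfk, hLk, huk, hck ▸ hμodd.mul hc₀odd⟩

/-! ## §2 Corollaries in the route's currencies -/

/-- **No rational `2`-torsion ⟹ `E[2]` irreducible** (over `ℚ`: a `Γ_ℚ`-stable line in `E[2]` is spanned by a rational point of order `2`, i.e. a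
rational root of the `2`-division cubic; tree theorems `not_hasIrreducibleModPGaloisRep_two_iff_exists_isRoot_twoTorsionPolynomial` and
`forall_not_isRoot_twoTorsionPolynomial_of_forall_two_nsmul`). [cite: SilvermanAEC2009, III.2.3 and Ex. III.3.7 (d)] -/
theorem hasIrreducibleModPGaloisRep_two_of_forall_two_smul_eq_zero (W : WeierstrassCurve ℚ) [W.IsElliptic]
    (hno : ∀ P : W.toAffine.Point, 2 • P = 0 → P = 0) : W.HasIrreducibleModPGaloisRep 2 := by
  by_contra h
  obtain ⟨x, hx⟩ := W.not_hasIrreducibleModPGaloisRep_two_iff_exists_isRoot_twoTorsionPolynomial.mp h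
  -- (the group law on `W(ℚ)` is read under `instDecidableEqRat` here and under the classical instance in the generic lemma)
  exact W.forall_not_isRoot_twoTorsionPolynomial_of_forall_two_nsmul two_ne_zero (fun P hP ↦ hno P (by convert hP)) x hx

/-- **`ρ̄_{W,2}` onto ⟹ `E[2]` irreducible** (the cut's hypothesis `∀ n ≥ 1, ρ_{W,2^n}` onto, at `n = 1`; tree theorem
`hasIrreducibleModPGaloisRep_of_hasSurjectiveModNGaloisRep`). [cite: Serre1972, §4] -/
theorem hasIrreducibleModPGaloisRep_two_of_forall_hasSurjectiveModNGaloisRep (W : WeierstrassCurve ℚ) [W.IsElliptic]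
    (hρ : ∀ n : ℕ, 0 < n → W.HasSurjectiveModNGaloisRep ((2 : ℤ) ^ n)) : W.HasIrreducibleModPGaloisRep 2 := by
  haveI : NeZero ((2 : ℕ) : ℚ) := ⟨by norm_num⟩
  have h1 : W.HasSurjectiveModNGaloisRep ((2 : ℕ) : ℤ) := by simpa using hρ 1 one_pos
  exact hasIrreducibleModPGaloisRep_of_hasSurjectiveModNGaloisRep W 2 h1

/-- **Rank one with `#Sel₂(W) = 2` ⟹ `E[2]` irreducible** (U₂'s own hypotheses: `#Sel₂ = 2` at Mordell–Weil rank `1` forces `W(ℚ)[2] = 0`, tree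
theorem `natCard_selmerGroup_two_ne_two_of_twoTorsion`; rank `1` from analytic rank `1` by GZK, displayed). [cite: SilvermanAEC2009, Thm. X.4.2] -/
theorem hasIrreducibleModPGaloisRep_two_of_analyticRank_one_of_natCard_selmerGroup_two
    (hGZK : rank_eq_analyticRank_of_analyticRank_le_one) (W : WeierstrassCurve ℚ) [W.IsElliptic] (hr : W.analyticRank = 1)
    (hSel : Nat.card (W.selmerGroup 2) = 2) : W.HasIrreducibleModPGaloisRep 2 := by
  have h1 : W.mordellWeilRank = 1 := ((hGZK W hr.le).1).trans hr
  refine hasIrreducibleModPGaloisRep_two_of_forall_two_smul_eq_zero W ?_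
  by_contra hT
  exact AnalyticTwin.NoTwoTorsion.Census.natCard_selmerGroup_two_ne_two_of_twoTorsion W h1 (fun h ↦ hT fun P hP ↦ h P (by convert hP)) hSel

/-- **The odd Manin datum at level `N_W`** (with the modularity fact `nonempty_modularParametrizationData` supplying some datum): for `W` globally
minimal with `E[2]` irreducible and `4 ∤ N_W`, `∃ Dt : ModularParametrizationData W N_W` with `Odd Dt.c`.  CONDITIONAL on AU + Čes + modularity;
BSD is NOT proved. [cite: AbbesUllmo1996, Thm. A] [cite: Cesnavicius2018, Thm. 1.2] [cite: BCDTJAMS2001, Thm. A] -/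
theorem exists_datum_odd_c_conductor_of_irreducible_two_of_not_four_dvd
    (hAU : abbesUllmo_not_dvd_maninConstant_of_not_dvd_level) (hCes : cesnavicius_not_two_dvd_maninConstant_of_two_dvd_level)
    (hmodD : nonempty_modularParametrizationData)
    (W : WeierstrassCurve ℚ) [W.IsElliptic] [W.IsGloballyMinimal] [NeZero (W.conductorNorm ℤ)] (hirr : W.HasIrreducibleModPGaloisRep 2)
    (h4 : ¬ 4 ∣ W.conductorNorm ℤ) :
    ∃ Dt : ModularParametrizationData W (W.conductorNorm ℤ), Odd Dt.c := by
  obtain ⟨D⟩ := hmodD W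
  obtain ⟨Dt, -, -, -, hodd⟩ := exists_datum_odd_c_of_irreducible_two_of_not_four_dvd hAU hCes W hirr D h4
  exact ⟨Dt, hodd⟩

/-- **The odd Manin datum on the odd habitat cut** (`ρ_{W,2^n}` onto for all `n ≥ 1`, `4 ∤ N_W`): `∃ Dt : ModularParametrizationData W N_W`,
`Odd Dt.c` — the «odd-`c` datum» conjunct of LINE 23's FRAME leaf is DISCHARGED on `4 ∤ N`, modulo AU + Čes + modularity.  BSD is NOT proved.
[cite: AbbesUllmo1996, Thm. A] [cite: Cesnavicius2018, Thm. 1.2] [cite: GreenbergVatsal2000, §3, Remark 3.4] -/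
theorem exists_datum_odd_c_conductor_of_forall_hasSurjectiveModNGaloisRep_of_not_four_dvd
    (hAU : abbesUllmo_not_dvd_maninConstant_of_not_dvd_level) (hCes : cesnavicius_not_two_dvd_maninConstant_of_two_dvd_level)
    (hmodD : nonempty_modularParametrizationData)
    (W : WeierstrassCurve ℚ) [W.IsElliptic] [W.IsGloballyMinimal] [NeZero (W.conductorNorm ℤ)]
    (hρ : ∀ n : ℕ, 0 < n → W.HasSurjectiveModNGaloisRep ((2 : ℤ) ^ n)) (h4 : ¬ 4 ∣ W.conductorNorm ℤ) :
    ∃ Dt : ModularParametrizationData W (W.conductorNorm ℤ), Odd Dt.c :=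
  exists_datum_odd_c_conductor_of_irreducible_two_of_not_four_dvd hAU hCes hmodD W
    (hasIrreducibleModPGaloisRep_two_of_forall_hasSurjectiveModNGaloisRep W hρ) h4

/-- **The odd Manin datum in U₂'s own hypotheses** (analytic rank `1`, `#Sel₂(W) = 2`, `4 ∤ N_W`): `∃ Dt : ModularParametrizationData W N_W`,
`Odd Dt.c`, modulo AU + Čes + modularity + GZK.  BSD is NOT proved; U₂ is NOT proved. [cite: AbbesUllmo1996, Thm. A] [cite: Cesnavicius2018, Thm. 1.2] -/
theorem exists_datum_odd_c_conductor_of_analyticRank_one_of_natCard_selmerGroup_two_of_not_four_dvd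
    (hAU : abbesUllmo_not_dvd_maninConstant_of_not_dvd_level) (hCes : cesnavicius_not_two_dvd_maninConstant_of_two_dvd_level)
    (hmodD : nonempty_modularParametrizationData) (hGZK : rank_eq_analyticRank_of_analyticRank_le_one)
    (W : WeierstrassCurve ℚ) [W.IsElliptic] [W.IsGloballyMinimal] [NeZero (W.conductorNorm ℤ)] (hr : W.analyticRank = 1)
    (hSel : Nat.card (W.selmerGroup 2) = 2) (h4 : ¬ 4 ∣ W.conductorNorm ℤ) :
    ∃ Dt : ModularParametrizationData W (W.conductorNorm ℤ), Odd Dt.c :=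
  exists_datum_odd_c_conductor_of_irreducible_two_of_not_four_dvd hAU hCes hmodD W
    (hasIrreducibleModPGaloisRep_two_of_analyticRank_one_of_natCard_selmerGroup_two hGZK W hr hSel) h4

/-! ## §3 The optimal case needs no isogeny -/

/-- **A lattice-optimal datum at a level `N` with `4 ∤ N` has odd Manin constant** — Abbes–Ullmo (`2 ∤ N`) / Česnavičius (`2 ∥ N`) verbatim, no
irreducibility needed: this is the habitat clause «`∃ Dt`, `Λ_W = c·Λ_f ∧ Odd Dt.c`» of `GenusPrimitiveSupplyAtTwo` (22136) read on `4 ∤ N`: the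
oddness conjunct is automatic there.  CONDITIONAL on the two named facts; BSD is NOT proved. [cite: AbbesUllmo1996, Thm. A]
[cite: Cesnavicius2018, Thm. 1.2 (p = 2, ord_2(n) = 1)] -/
theorem odd_c_of_latticeEq_of_not_four_dvd
    (hAU : abbesUllmo_not_dvd_maninConstant_of_not_dvd_level) (hCes : cesnavicius_not_two_dvd_maninConstant_of_two_dvd_level)
    (W : WeierstrassCurve ℚ) [W.IsElliptic] [W.IsGloballyMinimal] {N : ℕ} [NeZero N] (D : ModularParametrizationData W N)
    (hopt : ∀ z ∈ D.L.lattice, ∃ w ∈ periodLattice D.f, z = D.c * w) (h4 : ¬ 4 ∣ N) : Odd D.c := by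
  have hc : ¬ (2 : ℤ) ∣ D.c := by
    have h4' : ¬ 2 ^ 2 ∣ N := by norm_num; exact h4
    by_cases h2 : 2 ∣ N
    · exact hCes W D hopt h2 h4'
    · exact_mod_cast hAU W D hopt 2 Nat.prime_two h2
  rcases Int.even_or_odd D.c with h | h
  · exact absurd (even_iff_two_dvd.mp h) hc
  · exact h

/-- **On `4 ∤ N` the habitat clause «optimal with odd Manin constant» reduces to optimality**: `(∃ Dt, Λ_W = c·Λ_f ∧ Odd Dt.c) ↔ (∃ Dt, Λ_W = c·Λ_f)`,
modulo the two named facts. [cite: AbbesUllmo1996, Thm. A] [cite: Cesnavicius2018, Thm. 1.2] -/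
theorem exists_latticeEq_and_odd_iff_of_not_four_dvd
    (hAU : abbesUllmo_not_dvd_maninConstant_of_not_dvd_level) (hCes : cesnavicius_not_two_dvd_maninConstant_of_two_dvd_level)
    (W : WeierstrassCurve ℚ) [W.IsElliptic] [W.IsGloballyMinimal] {N : ℕ} [NeZero N] (h4 : ¬ 4 ∣ N) :
    (∃ Dt : ModularParametrizationData W N, (∀ z ∈ Dt.L.lattice, ∃ w ∈ periodLattice Dt.f, z = (Dt.c : ℂ) * w) ∧ Odd Dt.c) ↔
      ∃ Dt : ModularParametrizationData W N, ∀ z ∈ Dt.L.lattice, ∃ w ∈ periodLattice Dt.f, z = (Dt.c : ℂ) * w :=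
  ⟨fun ⟨Dt, hopt, _⟩ ↦ ⟨Dt, hopt⟩, fun ⟨Dt, hopt⟩ ↦ ⟨Dt, hopt, odd_c_of_latticeEq_of_not_four_dvd hAU hCes W Dt hopt h4⟩⟩

end Summit.BirchSwinnertonDyer.BirchSwinnertonDyer.Theorems.GenusExact.TwinSwap.OddManin

end
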